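import Literature.Dynamics.NBody.AlbouyKaloshin2012SymmetricCCsAll
import Literature.Dynamics.NBody.AlbouyKaloshin2012Scaling

/-!
# Mass scaling for reflection-symmetric central configurations: `(1,1,1,1,1/4)` versus `(4,4,4,4,1)`

Topic `Literature/Dynamics/NBody`; `pub-smale6` cell, seat 1 gen 3. [AlbouyKaloshin2012] Remark 8 (p. 583) names the
masses `(4,4,4,4,1)` (the positive-mass twin of Roberts' `(4,4,4,4,−1)`); the cell's slice systems are written for
`(1,1,b,b,c) = (1,1,1,1,1/4)`. System (1) is equivariant under `(m, q) ↦ (κ³ m, κ q)` (`κ > 0`), reflections in lines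
are conjugated accordingly, so `reflSymmCCs (κ³ m)` is the `κ`-dilate of `reflSymmCCs m` and one is finite iff the
other is: `reflSymmCCs_finite_iff_scale`, specialised in `reflSymmCCs_4441_finite_iff`. Elementary.
-/

namespace Literature.Dynamics.NBody

/-- `√(κ² s) = κ √s` for `κ ≥ 0`. [folklore] -/
theorem sqrt_sq_mul {κ s : ℝ} (hκ : 0 ≤ κ) : Real.sqrt (κ ^ 2 * s) = κ * Real.sqrt s := by
  rw [Real.sqrt_mul (sq_nonneg κ), Real.sqrt_sq hκ]

/-- **Scaling equivariance of system (1).** `f(κ³ m, κ q)_k = κ f(m, q)_k` for `κ > 0`.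
[cite: AlbouyKaloshin2012, system (1) p. 535] -/
theorem newtonForce_scale {n : ℕ} (m : Fin n → ℝ) (q : Fin n → ℝ × ℝ) {κ : ℝ} (hκ : 0 < κ) (k : Fin n) :
    newtonForce (fun l => κ ^ 3 * m l) (fun l => κ • q l) k = κ • newtonForce m q k := by
  rw [newtonForce_eq_sum_univ, newtonForce_eq_sum_univ, Finset.smul_sum]
  refine Finset.sum_congr rfl fun l _ => ?_
  rw [sqDist_smul, sqrt_sq_mul hκ.le, ← smul_sub, smul_smul, smul_smul]
  congr 1
  by_cases hs : Real.sqrt (sqDist (q k) (q l)) = 0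
  · simp [hs]
  · field_simp

/-- A positive normalized central configuration for `m` dilated by `κ > 0` is one for `κ³ m`.
[cite: AlbouyKaloshin2012, Definition 1 p. 536] -/
theorem isPositiveNormalizedCC_scale {n : ℕ} {m : Fin n → ℝ} {q : Fin n → ℝ × ℝ}
    (h : IsPositiveNormalizedCC m q) {κ : ℝ} (hκ : 0 < κ) :
    IsPositiveNormalizedCC (fun l => κ ^ 3 * m l) (fun l => κ • q l) := by
  obtain ⟨hd, hcc, hn⟩ := h
  refine ⟨?_, ?_, ?_⟩
  · intro k l hkl heq
    exact hd k l hkl (smul_right_injective (ℝ × ℝ) hκ.ne' heq)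
  · intro k
    rw [newtonForce_scale m q hκ k, ← hcc k]
  · intro h0 h1
    show (κ • q ⟨1, h1⟩).2 = (κ • q ⟨0, h0⟩).2
    simp only [Prod.smul_snd, smul_eq_mul, hn h0 h1]

/-- Dilation conjugates the reflection in the line `a x + β y = d` to the reflection in `a x + β y = κ d`. [folklore] -/
theorem reflLine_smul (a β d κ : ℝ) (p : ℝ × ℝ) : reflLine a β (κ * d) (κ • p) = κ • reflLine a β d p := by
  ext <;> simp [reflLine] <;> ring

/-- The `κ`-dilate of a reflection-symmetric positive normalized CC for `m` is one for `κ³ m`. [folklore] -/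
theorem smul_mem_reflSymmCCs {m : Fin 5 → ℝ} {q : Fin 5 → ℝ × ℝ} (hq : q ∈ reflSymmCCs m) {κ : ℝ} (hκ : 0 < κ) :
    (fun l => κ • q l) ∈ reflSymmCCs (fun l => κ ^ 3 * m l) := by
  obtain ⟨hcc, a, β, d, hab, hsym⟩ := hq
  refine ⟨isPositiveNormalizedCC_scale hcc hκ, a, β, κ * d, hab, fun k => ?_⟩
  obtain ⟨l, hml, hl⟩ := hsym k
  exact ⟨l, by simp only [hml], by rw [reflLine_smul, hl]⟩

/-- One direction of the scaling invariance of finiteness. [folklore] -/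
theorem reflSymmCCs_finite_of_scale {m : Fin 5 → ℝ} {κ : ℝ} (hκ : 0 < κ)
    (h : (reflSymmCCs (fun l => κ ^ 3 * m l)).Finite) : (reflSymmCCs m).Finite := by
  have hinj : Set.InjOn (fun q : Fin 5 → ℝ × ℝ => fun l => κ • q l) (reflSymmCCs m) := by
    intro q _ q' _ hqq'
    funext l
    exact smul_right_injective (ℝ × ℝ) hκ.ne' (congrFun hqq' l)
  exact Set.Finite.of_finite_image (h.subset (by rintro _ ⟨q, hq, rfl⟩; exact smul_mem_reflSymmCCs hq hκ)) hinj

/-- **Finiteness of the reflection-symmetric positive normalized CCs is invariant under mass scaling.** [folklore] -/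
theorem reflSymmCCs_finite_iff_scale {m : Fin 5 → ℝ} {κ : ℝ} (hκ : 0 < κ) :
    (reflSymmCCs (fun l => κ ^ 3 * m l)).Finite ↔ (reflSymmCCs m).Finite := by
  refine ⟨reflSymmCCs_finite_of_scale hκ, fun h => ?_⟩
  refine reflSymmCCs_finite_of_scale (κ := κ⁻¹) (inv_pos.mpr hκ) ?_
  have : (fun l => κ⁻¹ ^ 3 * (κ ^ 3 * m l)) = m := by
    funext l
    field_simp
  rwa [this]

/-- **`(4,4,4,4,1)` versus `(1,1,1,1,1/4)`.** The reflection-symmetric positive normalized central configurations of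
the Remark-8 masses `(4,4,4,4,1)` are finite in number iff those of `(1,1,1,1,1/4) = e32Masses 1 (1/4)` are (dilation
by `4^{1/3}`). [cite: AlbouyKaloshin2012, Remark 8 p. 583] -/
theorem reflSymmCCs_4441_finite_iff :
    (reflSymmCCs ![4, 4, 4, 4, 1]).Finite ↔ (reflSymmCCs (e32Masses 1 (1 / 4))).Finite := by
  have hκ : (0 : ℝ) < (4 : ℝ) ^ (1 / 3 : ℝ) := Real.rpow_pos_of_pos (by norm_num) _
  have hκ3 : ((4 : ℝ) ^ (1 / 3 : ℝ)) ^ 3 = 4 := by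
    rw [← Real.rpow_natCast, ← Real.rpow_mul (by norm_num)]
    norm_num
  have hm : (![4, 4, 4, 4, 1] : Fin 5 → ℝ) = fun l => ((4 : ℝ) ^ (1 / 3 : ℝ)) ^ 3 * e32Masses 1 (1 / 4) l := by
    funext l
    rw [hκ3]
    fin_cases l <;> simp [e32Masses]
  rw [hm]
  exact reflSymmCCs_finite_iff_scale hκ

end Literature.Dynamics.NBody
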